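import Summits.ValiantsHypothesis.ValiantsHypothesis.Theses.PartialSorting

/-!
# PartialSorting — `Assembly` (item stmt-ValiantsHypothesis-13598):
`CutDetNotVP → BruhatDetInVNP → ValiantsHypothesis`

The rank-1 assembly item of route `PartialSorting`.  The route's deciding theorem
`Theses.PartialSorting.closes` takes `Target` (some rank-truncated determinant family
`D_{w_n} = Σ_{σ ≤ w_n} sgn σ · x^σ`, `σ ≤ w` by the Björner–Brenti rank criterion, is not a `VP`
family over `ℂ`) and `BruhatDetInVNP` (every such family is a `VNP` family) to `VP_ℂ ≠ VNP_ℂ`.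
The assembly records that the concrete crux `CutDetNotVP` — the cut-width-`⌊n/4⌋` truncation
`CutDet_n = D_{w⋆_n}` is not a `VP` family — already supplies `Target`: exhibit the explicit
sequence `w⋆_n a = rev a` if `a < ⌊n/4⌋` or `n - ⌊n/4⌋ ≤ a`, else `a` (the two `IsVPFamily`
statements then agree definitionally), and compose with `closes`.  Pure logic; no analytic or
combinatorial content (Valiant 1979, Bürgisser 2000 enter only through `closes`).
-/

-- `Summit.ValiantsHypothesis.ValiantsHypothesis.…` is the tree's mandated single-conjunct layout
-- (Sub = Summit), so the duplicated namespace component is intended.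
set_option linter.dupNamespace false

namespace Summit.ValiantsHypothesis.ValiantsHypothesis.Theorems.PartialSortingAssembly

open Summit.ValiantsHypothesis.ValiantsHypothesis.Theses.PartialSorting

/-- **Assembly** (item stmt-ValiantsHypothesis-13598 of route `PartialSorting`):
`CutDetNotVP → BruhatDetInVNP → ValiantsHypothesis`.  From `CutDetNotVP` obtain `Target` with the
witness `w⋆_n a = Fin.rev a` if `a < n/4 ∨ n - n/4 ≤ a`, else `a` (the cut-width truncation
`CutDet_n` is by definition the rank-truncated determinant `D_{w⋆_n}`), then apply the route's
deciding theorem `closes` (were `VP ℂ = VNP ℂ`, `BruhatDetInVNP w⋆` and the bundling bridges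
`mem_VNP_ofFintype_iff_holds`, `mem_VP_ofFintype_iff_holds` would make `CutDet` a `VP` family).
[folklore] -/
theorem assembly_proof :
    Summit.ValiantsHypothesis.ValiantsHypothesis.Theses.PartialSorting.Assembly := by
  unfold Summit.ValiantsHypothesis.ValiantsHypothesis.Theses.PartialSorting.Assembly
  intro hCut hVNP
  exact closes
    ⟨fun n a => if ((a : ℕ) < n / 4 ∨ n - n / 4 ≤ (a : ℕ)) then Fin.rev a else a, hCut⟩ hVNP

end Summit.ValiantsHypothesis.ValiantsHypothesis.Theorems.PartialSortingAssembly
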